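import Summits.CriticalPhenomena.PercolationContinuityZ3.Theorems.PercNearOneGluingNoHeavyLowerTailSahiCTCLadderThreeRowThreeZeroFacts
import Summits.CriticalPhenomena.PercolationContinuityZ3.Theorems.PercNearOneGluingNoHeavyLowerTailSahiCTCLadderThreeRowThreeZeroArith
import Summits.CriticalPhenomena.PercolationContinuityZ3.Theorems.PercNearOneGluingNoHeavyLowerTailSahiCTCLadderThreeRowThreeCaseII
import HarnessLib

/-!
# `NoHeavyLowerTail` (crux stmt-CriticalPhenomena-4575), P3 lane: the row `#dbl = 3` of `(L_3)` — the half `D ∉ 𝒳 ∩ 𝒵` and the full row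

Support file (seat `prim-l12-p3`, gen 26; `--supports stmt-CriticalPhenomena-4575`).  Paper proof `prim-l12-p3/ROW3-PROOF-g26.md` §6.
THEOREMS: `coeff_ladder_three_rowThree_nonneg_nalpha` — for 3-live up-sets, `m ≤ 2`, `#dbl m = 3`, `dbl m ∉ 𝒳 ∩ 𝒵`, `τ ≥ 12`:
`[m](e_3·H − Θ_2·e_{≥3}·GF(W_3)) ≥ 0` (sorted C-sizes, nine patterns dispatched to `rowThree_zarith_*`); and the whole row,
**`coeff_ladder_three_rowThree_nonneg`**: `#dbl m = 3`, `τ ≥ 18` ⇒ `[m] L_3 ≥ 0` (with `…_alpha` of `…RowThreeCaseII`).  Together with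
`…LadderThreeRowFour` (row 4), `…LadderRowTopT` (rows ≥ 5) and `…LadderThreeReduction` this leaves, for `(L_3)`, the rows `#dbl ∈ {1,2}` and
the finitely many profiles with `τ` below the thresholds.  Nothing is asserted about the crux.
-/

namespace Summit.CriticalPhenomena.PercolationContinuityZ3.Theorems.SahiCTCForms

open Finset MvPolynomial SahiCTCGenFun SahiCTCWeightedLYM

variable {α : Type*} [DecidableEq α] [Fintype α]

section RowThreeZeroMain
variable {𝒳 𝒵 : Finset (Finset α)}

omit [Fintype α] in
/-- A set with at least two points is contained in at most one 2-subset. [folklore] -/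
theorem card_pairs_supset_le_one {T C : Finset α} (hC : 2 ≤ #C) : #((T.powersetCard 2).filter fun Q => C ⊆ Q) ≤ 1 := by
  refine card_le_one.2 fun Q hQ Q' hQ' => ?_
  obtain ⟨hQ1, hQ2⟩ := mem_filter.1 hQ
  obtain ⟨hQ1', hQ2'⟩ := mem_filter.1 hQ'
  have e1 : C = Q := eq_of_subset_of_card_le hQ2 (by rw [(mem_powersetCard.1 hQ1).2]; exact hC)
  have e2 : C = Q' := eq_of_subset_of_card_le hQ2' (by rw [(mem_powersetCard.1 hQ1').2]; exact hC)
  rw [← e1, ← e2]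

omit [Fintype α] in
/-- A singleton `{w} ⊆ T` is contained in at most `#T − 1` of the 2-subsets of `T`. [folklore] -/
theorem card_pairs_supset_le_of_card_one {T C : Finset α} (hC : #C = 1) (hCT : C ⊆ T) :
    #((T.powersetCard 2).filter fun Q => C ⊆ Q) ≤ #T - 1 := by
  obtain ⟨w, rfl⟩ := card_eq_one.1 hC
  have hw : w ∈ T := hCT (mem_singleton_self w)
  rw [← card_erase_of_mem hw]
  have hsub : ((T.powersetCard 2).filter fun Q => {w} ⊆ Q) ⊆ (T.erase w).image fun u => ({w, u} : Finset α) := fun Q hQ => by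
    obtain ⟨hQ1, hQ2⟩ := mem_filter.1 hQ
    obtain ⟨hQT, hQc⟩ := mem_powersetCard.1 hQ1
    have hwQ : w ∈ Q := hQ2 (mem_singleton_self w)
    obtain ⟨u, hu⟩ : (Q.erase w).Nonempty := card_pos.1 (by rw [card_erase_of_mem hwQ, hQc]; norm_num)
    refine mem_image.2 ⟨u, mem_erase.2 ⟨ne_of_mem_erase hu, hQT (mem_of_mem_erase hu)⟩, ?_⟩
    exact eq_of_subset_of_card_le (insert_subset hwQ (singleton_subset_iff.2 (mem_of_mem_erase hu)))
      (by rw [hQc, card_pair (ne_of_mem_erase hu).symm])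
  exact (card_le_card hsub).trans card_image_le

omit [Fintype α] in
/-- The 1-live cubes have nonnegative surplus. [this work] -/
theorem sum_kapL1_nonneg (h𝒳 : IsUpperSet (𝒳 : Set (Finset α))) (h𝒵 : IsUpperSet (𝒵 : Set (Finset α))) (m : α →₀ ℕ) (d : α) :
    (0 : ℤ) ≤ ∑ Q ∈ (lev m 1).powersetCard 2, kapL1 𝒳 𝒵 m d Q :=
  sum_nonneg fun Q _ => by
    unfold kapL1; exact kap_nonneg h𝒳 h𝒵 _ _ (by
      rw [disjoint_insert_right]
      exact ⟨notMem_erase d _, Disjoint.mono (erase_subset d (dbl m)) (sdiff_subset (s := lev m 1) (t := Q)) (disjoint_dbl_lev_one m)⟩)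

/-- **Row `#dbl = 3` of `(L_3)`, half `D ∉ 𝒳 ∩ 𝒵`, sorted labelling** (ROW3-PROOF §6; `τ ≥ 12`). [this work] -/
theorem rowThree_zero_sorted (h𝒳 : IsUpperSet (𝒳 : Set (Finset α))) (h𝒵 : IsUpperSet (𝒵 : Set (Finset α)))
    (hX3 : ∀ S ∈ 𝒳, 3 ≤ #S) (hZ3 : ∀ S ∈ 𝒵, 3 ≤ #S) {m : α →₀ ℕ} (hm : ∀ i, m i ≤ 2) (hD : #(dbl m) = 3)
    (hτ : 12 ≤ #(lev m 1)) (hnD : ¬ (dbl m ∈ 𝒳 ∧ dbl m ∈ 𝒵)) {d₁ d₂ d₃ : α} (hDeq : dbl m = {d₁, d₂, d₃}) (h12 : d₁ ≠ d₂)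
    (h13 : d₁ ≠ d₃) (h23 : d₂ ≠ d₃) (hs12 : cE 𝒳 𝒵 m d₂ ≤ cE 𝒳 𝒵 m d₁) (hs23 : cE 𝒳 𝒵 m d₃ ≤ cE 𝒳 𝒵 m d₂) :
    0 ≤ (ee 3 * (PiP * gf (𝒳 ∩ 𝒵) - gf 𝒳 * gf 𝒵) -
      gf (bySize (· ≤ 3 - 1) : Finset (Finset α)) * gf (bySize (3 ≤ ·) : Finset (Finset α)) *
        gf ((𝒳 ∩ 𝒵).filter fun S => #S = 3)).coeff m := by
  have hd₁ : d₁ ∈ dbl m := by rw [hDeq]; simp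
  have hd₂ : d₂ ∈ dbl m := by rw [hDeq]; simp
  have hd₃ : d₃ ∈ dbl m := by rw [hDeq]; simp
  have he₁₂ : d₂ ∈ (dbl m).erase d₁ := mem_erase.2 ⟨h12.symm, hd₂⟩
  have he₁₃ : d₃ ∈ (dbl m).erase d₁ := mem_erase.2 ⟨h13.symm, hd₃⟩
  have he₂₃ : d₃ ∈ (dbl m).erase d₂ := mem_erase.2 ⟨h23.symm, hd₃⟩
  have he₃₂ : d₂ ∈ (dbl m).erase d₃ := mem_erase.2 ⟨h23, hd₂⟩
  set W := (𝒳 ∩ 𝒵).filter fun S => #S = 3 with hWdef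
  have hW3 : ∀ w ∈ W, #w = 3 := fun w hw => (mem_filter.1 hw).2
  have hWsub : ∀ w ∈ W, w ∈ 𝒳 ∧ w ∈ 𝒵 := fun w hw => mem_inter.1 (mem_filter.1 hw).1
  have hDW : dbl m ∉ W := fun h => hnD (hWsub _ h)
  have hDT : Disjoint (dbl m) (lev m 1) := disjoint_dbl_lev_one m
  rw [coeff_sub, sub_nonneg]
  refine (coeff_chargeT_rowThree_le hm hD (by omega) W hW3).trans
    (le_trans ?_ (cubes_le_coeff_ee_mul_harris_rowThree h𝒳 h𝒵 hm hD))
  rw [if_neg hDW, zero_add]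
  set τ := #(lev m 1) with hτdef
  have hn₁ : d₁ ∉ ({d₂, d₃} : Finset α) := by simp [h12, h13]
  have hn₂ : d₂ ∉ ({d₃} : Finset α) := by simp [h23]
  have hsumD : ∀ f : α → ℤ, ∑ d ∈ dbl m, f d = f d₁ + f d₂ + f d₃ := fun f => by
    rw [hDeq, sum_insert hn₁, sum_insert hn₂, sum_singleton]; ring
  have hsumDn : ∀ f : α → ℕ, ∑ d ∈ dbl m, f d = f d₁ + f d₂ + f d₃ := fun f => by
    rw [hDeq, sum_insert hn₁, sum_insert hn₂, sum_singleton]; ring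
  -- charge pieces
  have hqW : ∀ d, #(((lev m 1).powersetCard 2).filter fun Q => insert d Q ∈ W) ≤ #(qset 𝒳 𝒵 m d) := fun d =>
    card_le_card fun Q hQ => mem_filter.2 ⟨(mem_filter.1 hQ).1, hWsub _ (mem_filter.1 hQ).2⟩
  have hWC1 : (#((W.filter fun w => ind w ≤ m).filter fun w => #(dbl m ∩ w) = 1) : ℤ) ≤
      #(qset 𝒳 𝒵 m d₁) + #(qset 𝒳 𝒵 m d₂) + #(qset 𝒳 𝒵 m d₃) := by
    have h1 := (card_WC1_le_sum hm W hW3).trans (sum_le_sum fun d (_ : d ∈ dbl m) => hqW d)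
    rw [hsumDn] at h1; exact_mod_cast h1
  have hWC2 : (#((W.filter fun w => ind w ≤ m).filter fun w => #(dbl m ∩ w) = 2) : ℤ) ≤
      (cE 𝒳 𝒵 m d₁ : ℤ) + cE 𝒳 𝒵 m d₂ + cE 𝒳 𝒵 m d₃ := by
    have h1 := card_WC2_le_sum_cE hm hD W hW3 hWsub (𝒳 := 𝒳) (𝒵 := 𝒵)
    rw [hsumDn] at h1; exact_mod_cast h1
  have hWC2' : (0 : ℤ) ≤ #((W.filter fun w => ind w ≤ m).filter fun w => #(dbl m ∩ w) = 2) := Nat.cast_nonneg _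
  -- the restriction cube pays 2 per point of C(D∖d₁)
  have hR : 2 * (cE 𝒳 𝒵 m d₁ : ℤ) ≤ kapR 𝒳 𝒵 m := by
    unfold cE
    exact two_mul_card_le_kapR h𝒳 h𝒵 hX3 hZ3 hD (filter_subset _ _) fun y hy => ⟨d₁, hd₁, (mem_filter.1 hy).2⟩
  -- C-sizes seen: family d₁ sees #csetL2 d₁ d₃ = cE d₂; families d₂, d₃ see #csetL2 d₂ d₃ = cE d₁ = #csetL2 d₃ d₂
  have hc₁₃ : (#(csetL2 𝒳 𝒵 m d₁ d₃) : ℤ) = cE 𝒳 𝒵 m d₂ := by rw [card_csetL2_eq_cE hD hd₁ hd₃ hd₂ h13 h12 h23.symm]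
  have hc₂₃ : (#(csetL2 𝒳 𝒵 m d₂ d₃) : ℤ) = cE 𝒳 𝒵 m d₁ := by rw [card_csetL2_eq_cE hD hd₂ hd₃ hd₁ h23 h12.symm h13.symm]
  have hc₃₂ : (#(csetL2 𝒳 𝒵 m d₃ d₂) : ℤ) = cE 𝒳 𝒵 m d₁ := by rw [card_csetL2_eq_cE hD hd₃ hd₂ hd₁ h23.symm h13.symm h12.symm]
  have hγle : ∀ d, (cE 𝒳 𝒵 m d : ℤ) ≤ τ := fun d => by unfold cE; exact_mod_cast card_filter_le _ _
  have hτ2 : 2 ≤ #(lev m 1) := by omega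
  have hτ4 : 4 ≤ #(lev m 1) := by omega
  have hτ' : (12 : ℤ) ≤ τ := by exact_mod_cast hτ
  -- L₀-facts (usable when the seen C-set is nonempty)
  have hL₁ : 1 ≤ cE 𝒳 𝒵 m d₂ → (τ : ℤ) + (τ - 1) * (cE 𝒳 𝒵 m d₂ : ℤ) - 1 ≤ ∑ y₀ ∈ lev m 1, kapL2 𝒳 𝒵 m d₁ y₀ := fun h => by
    have := sum_kapL2_ge_deg_one h𝒳 h𝒵 hX3 hZ3 hD hτ2 hd₁ he₁₃ (by have := hc₁₃; omega); rwa [hc₁₃] at this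
  have hL₂ : 1 ≤ cE 𝒳 𝒵 m d₁ → (τ : ℤ) + (τ - 1) * (cE 𝒳 𝒵 m d₁ : ℤ) - 1 ≤ ∑ y₀ ∈ lev m 1, kapL2 𝒳 𝒵 m d₂ y₀ := fun h => by
    have := sum_kapL2_ge_deg_one h𝒳 h𝒵 hX3 hZ3 hD hτ2 hd₂ he₂₃ (by have := hc₂₃; omega); rwa [hc₂₃] at this
  have hL₃ : 1 ≤ cE 𝒳 𝒵 m d₁ → (τ : ℤ) + (τ - 1) * (cE 𝒳 𝒵 m d₁ : ℤ) - 1 ≤ ∑ y₀ ∈ lev m 1, kapL2 𝒳 𝒵 m d₃ y₀ := fun h => by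
    have := sum_kapL2_ge_deg_one h𝒳 h𝒵 hX3 hZ3 hD hτ2 hd₃ he₃₂ (by have := hc₃₂; omega); rwa [hc₃₂] at this
  have hL0τ : ∀ d, (τ : ℤ) + (τ - 1) * (cE 𝒳 𝒵 m d : ℤ) - 1 ≤ (τ : ℤ) ^ 2 := fun d => by nlinarith [hγle d]
  have hL0τ' : ∀ d, 1 ≤ cE 𝒳 𝒵 m d → (τ : ℤ) - 2 ≤ (τ : ℤ) + (τ - 1) * (cE 𝒳 𝒵 m d : ℤ) - 1 := fun d h => by
    have : (1 : ℤ) ≤ cE 𝒳 𝒵 m d := by exact_mod_cast h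
    nlinarith
  have h0L : ∀ d ∈ dbl m, (0 : ℤ) ≤ ∑ y₀ ∈ lev m 1, kapL2 𝒳 𝒵 m d y₀ := fun d hd => by
    have := phi_nonneg h𝒳 h𝒵 hX3 hZ3 hD hτ4 hd (𝒳 := 𝒳) (𝒵 := 𝒵); have h0 : (0 : ℤ) ≤ #(qset 𝒳 𝒵 m d) := Nat.cast_nonneg _; linarith
  have hτsq : (0 : ℤ) ≤ (τ : ℤ) ^ 2 := sq_nonneg _
  -- F-bounds
  set C₁ := (lev m 1).filter fun y => insert y ((dbl m).erase d₁) ∈ 𝒳 ∧ insert y ((dbl m).erase d₁) ∈ 𝒵 with hC₁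
  set C₂ := (lev m 1).filter fun y => insert y ((dbl m).erase d₂) ∈ 𝒳 ∧ insert y ((dbl m).erase d₂) ∈ 𝒵 with hC₂
  set C₃ := (lev m 1).filter fun y => insert y ((dbl m).erase d₃) ∈ 𝒳 ∧ insert y ((dbl m).erase d₃) ∈ 𝒵 with hC₃
  have hcC : ∀ {d : α} {C : Finset α}, C = (lev m 1).filter (fun y => insert y ((dbl m).erase d) ∈ 𝒳 ∧ insert y ((dbl m).erase d) ∈ 𝒵) →
      #C = cE 𝒳 𝒵 m d := fun {d C} h => by rw [h]; rfl
  have hF1 : ∀ {d : α} {C : Finset α}, C = (lev m 1).filter (fun y => insert y ((dbl m).erase d) ∈ 𝒳 ∧ insert y ((dbl m).erase d) ∈ 𝒵) →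
      cE 𝒳 𝒵 m d = 1 → (#(((lev m 1).powersetCard 2).filter fun Q => C ⊆ Q) : ℤ) ≤ τ - 1 := fun {d C} h h1 => by
    have := card_pairs_supset_le_of_card_one (T := lev m 1) (C := C) (by rw [hcC h, h1]) (by rw [h]; exact filter_subset _ _)
    have h1' : 1 ≤ #(lev m 1) := by omega
    zify [h1'] at this; exact this
  have hF2 : ∀ {d : α} {C : Finset α}, C = (lev m 1).filter (fun y => insert y ((dbl m).erase d) ∈ 𝒳 ∧ insert y ((dbl m).erase d) ∈ 𝒵) →
      2 ≤ cE 𝒳 𝒵 m d → (#(((lev m 1).powersetCard 2).filter fun Q => C ⊆ Q) : ℤ) ≤ 1 := fun {d C} h h2 => by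
    have := card_pairs_supset_le_one (T := lev m 1) (C := C) (by rw [hcC h]; exact h2)
    exact_mod_cast this
  -- family facts (instantiated lazily below)
  have hΦpos := fun (d : α) (hd : d ∈ dbl m) {L₀ : ℤ} (hL₀ : L₀ ≤ ∑ y₀ ∈ lev m 1, kapL2 𝒳 𝒵 m d y₀) (hL₀' : L₀ ≤ (τ : ℤ) ^ 2) =>
    phi_pos_fact h𝒳 h𝒵 hX3 hZ3 hD hτ hd hL₀ hL₀'
  have hΦzero := fun (d : α) (hd : d ∈ dbl m) {L₀ : ℤ} (hL₀ : L₀ ≤ ∑ y₀ ∈ lev m 1, kapL2 𝒳 𝒵 m d y₀) (hL₀' : L₀ ≤ (τ : ℤ) ^ 2)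
    (hL₀'' : (τ : ℤ) - 2 ≤ L₀) => phi_zero_fact h𝒳 h𝒵 hX3 hZ3 hD hτ4 hd hL₀ hL₀' hL₀''
  have hΦnn := fun (d : α) (hd : d ∈ dbl m) => phi_nonneg h𝒳 h𝒵 hX3 hZ3 hD hτ4 hd (𝒳 := 𝒳) (𝒵 := 𝒵)
  have hK := fun (d : α) => sum_kapL1_nonneg h𝒳 h𝒵 m d (𝒳 := 𝒳) (𝒵 := 𝒵)
  -- the goal in family form
  rw [hsumD fun d => ∑ y₀ ∈ lev m 1, kapL2 𝒳 𝒵 m d y₀, hsumD fun d => ∑ Q ∈ (lev m 1).powersetCard 2, kapL1 𝒳 𝒵 m d Q]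
  have hγ1 := hγle d₁
  have hs12' : (cE 𝒳 𝒵 m d₂ : ℤ) ≤ cE 𝒳 𝒵 m d₁ := by exact_mod_cast hs12
  have hs23' : (cE 𝒳 𝒵 m d₃ : ℤ) ≤ cE 𝒳 𝒵 m d₂ := by exact_mod_cast hs23
  -- dispatch on the types of γ₁ ≥ γ₂ ≥ γ₃
  rcases Nat.lt_or_ge (cE 𝒳 𝒵 m d₁) 1 with h1 | h1
  · -- all zero
    have e1 : cE 𝒳 𝒵 m d₁ = 0 := by omega
    have e2 : cE 𝒳 𝒵 m d₂ = 0 := by omega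
    have e3 : cE 𝒳 𝒵 m d₃ = 0 := by omega
    have := hΦnn d₁ hd₁; have := hΦnn d₂ hd₂; have := hΦnn d₃ hd₃
    have := hK d₁; have := hK d₂; have := hK d₃
    have hR0 : (0 : ℤ) ≤ kapR 𝒳 𝒵 m := by linarith [hR, show (0:ℤ) ≤ cE 𝒳 𝒵 m d₁ from Nat.cast_nonneg _]
    rw [e1, e2, e3] at hWC2; push_cast at hWC2
    nlinarith [hWC2, hWC2', hWC1, hR0]
  rcases Nat.lt_or_ge (cE 𝒳 𝒵 m d₁) 2 with h1' | h1'
  · -- γ₁ = 1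
    have e1 : cE 𝒳 𝒵 m d₁ = 1 := by omega
    rcases Nat.lt_or_ge (cE 𝒳 𝒵 m d₂) 1 with h2 | h2
    · -- (1,0,0)
      have e2 : cE 𝒳 𝒵 m d₂ = 0 := by omega
      have e3 : cE 𝒳 𝒵 m d₃ = 0 := by omega
      exact rowThree_zarith_100 hτ' hR hWC1 hWC2 hWC2' hs12' hs23' hγ1 (hK d₂) (hK d₃) (by exact_mod_cast e1) (by exact_mod_cast e2)
        (by exact_mod_cast e3) (hΦpos d₁ hd₁ (h0L d₁ hd₁) hτsq) (hF1 hC₁ e1) (hΦzero d₂ hd₂ (hL₂ h1) (hL0τ d₁) (hL0τ' d₁ h1))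
        (hΦzero d₃ hd₃ (hL₃ h1) (hL0τ d₁) (hL0τ' d₁ h1))
    · have e2 : cE 𝒳 𝒵 m d₂ = 1 := by omega
      rcases Nat.lt_or_ge (cE 𝒳 𝒵 m d₃) 1 with h3 | h3
      · -- (1,1,0)
        have e3 : cE 𝒳 𝒵 m d₃ = 0 := by omega
        exact rowThree_zarith_110 hτ' hR hWC1 hWC2 hWC2' hs12' hs23' hγ1 (hK d₃) (by exact_mod_cast e1) (by exact_mod_cast e2)
          (by exact_mod_cast e3) (hΦpos d₁ hd₁ (hL₁ h2) (hL0τ d₂)) (hF1 hC₁ e1) (hΦpos d₂ hd₂ (hL₂ h1) (hL0τ d₁)) (hF1 hC₂ e2)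
          (hΦzero d₃ hd₃ (hL₃ h1) (hL0τ d₁) (hL0τ' d₁ h1))
      · -- (1,1,1)
        have e3 : cE 𝒳 𝒵 m d₃ = 1 := by omega
        exact rowThree_zarith_111 hτ' hR hWC1 hWC2 hs12' hs23' hγ1 (by exact_mod_cast e1)
          (hΦpos d₁ hd₁ (hL₁ h2) (hL0τ d₂)) (hF1 hC₁ e1) (hΦpos d₂ hd₂ (hL₂ h1) (hL0τ d₁)) (hF1 hC₂ e2)
          (hΦpos d₃ hd₃ (hL₃ h1) (hL0τ d₁)) (hF1 hC₃ e3)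
  · -- γ₁ ≥ 2
    rcases Nat.lt_or_ge (cE 𝒳 𝒵 m d₂) 1 with h2 | h2
    · -- (2,0,0)
      have e2 : cE 𝒳 𝒵 m d₂ = 0 := by omega
      have e3 : cE 𝒳 𝒵 m d₃ = 0 := by omega
      exact rowThree_zarith_200 hτ' hR hWC1 hWC2 hWC2' hs12' hs23' hγ1 (hK d₂) (hK d₃) (by exact_mod_cast h1') (by exact_mod_cast e2)
        (by exact_mod_cast e3) (hΦpos d₁ hd₁ (h0L d₁ hd₁) hτsq) (hF2 hC₁ h1') (hΦzero d₂ hd₂ (hL₂ h1) (hL0τ d₁) (hL0τ' d₁ h1))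
        (hΦzero d₃ hd₃ (hL₃ h1) (hL0τ d₁) (hL0τ' d₁ h1))
    rcases Nat.lt_or_ge (cE 𝒳 𝒵 m d₂) 2 with h2' | h2'
    · have e2 : cE 𝒳 𝒵 m d₂ = 1 := by omega
      rcases Nat.lt_or_ge (cE 𝒳 𝒵 m d₃) 1 with h3 | h3
      · -- (2,1,0)
        have e3 : cE 𝒳 𝒵 m d₃ = 0 := by omega
        exact rowThree_zarith_210 hτ' hR hWC1 hWC2 hWC2' hs12' hs23' hγ1 (hK d₃) (by exact_mod_cast h1') (by exact_mod_cast e2)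
          (by exact_mod_cast e3) (hΦpos d₁ hd₁ (hL₁ h2) (hL0τ d₂)) (hF2 hC₁ h1') (hΦpos d₂ hd₂ (hL₂ h1) (hL0τ d₁)) (hF1 hC₂ e2)
          (hΦzero d₃ hd₃ (hL₃ h1) (hL0τ d₁) (hL0τ' d₁ h1))
      · -- (2,1,1)
        have e3 : cE 𝒳 𝒵 m d₃ = 1 := by omega
        exact rowThree_zarith_211 hτ' hR hWC1 hWC2 hs12' hs23' hγ1 (by exact_mod_cast e2)
          (hΦpos d₁ hd₁ (hL₁ h2) (hL0τ d₂)) (hF2 hC₁ h1') (hΦpos d₂ hd₂ (hL₂ h1) (hL0τ d₁)) (hF1 hC₂ e2)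
          (hΦpos d₃ hd₃ (hL₃ h1) (hL0τ d₁)) (hF1 hC₃ e3)
    · rcases Nat.lt_or_ge (cE 𝒳 𝒵 m d₃) 1 with h3 | h3
      · -- (2,2,0)
        have e3 : cE 𝒳 𝒵 m d₃ = 0 := by omega
        exact rowThree_zarith_220 hτ' hR hWC1 hWC2 hs12' (hK d₃) (by exact_mod_cast h1') (by exact_mod_cast e3)
          (hΦpos d₁ hd₁ (hL₁ h2) (hL0τ d₂)) (hF2 hC₁ h1') (hΦpos d₂ hd₂ (hL₂ h1) (hL0τ d₁)) (hF2 hC₂ h2')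
          (hΦzero d₃ hd₃ (hL₃ h1) (hL0τ d₁) (hL0τ' d₁ h1))
      rcases Nat.lt_or_ge (cE 𝒳 𝒵 m d₃) 2 with h3' | h3'
      · -- (2,2,1)
        have e3 : cE 𝒳 𝒵 m d₃ = 1 := by omega
        exact rowThree_zarith_221 hτ' hR hWC1 hWC2 hs12' hs23' hγ1 (by exact_mod_cast h2') (by exact_mod_cast e3)
          (hΦpos d₁ hd₁ (hL₁ h2) (hL0τ d₂)) (hF2 hC₁ h1') (hΦpos d₂ hd₂ (hL₂ h1) (hL0τ d₁)) (hF2 hC₂ h2')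
          (hΦpos d₃ hd₃ (hL₃ h1) (hL0τ d₁)) (hF1 hC₃ e3)
      · -- (2,2,2)
        exact rowThree_zarith_222 hτ' hR hWC1 hWC2 hs12' hs23' hγ1
          (hΦpos d₁ hd₁ (hL₁ h2) (hL0τ d₂)) (hF2 hC₁ h1') (hΦpos d₂ hd₂ (hL₂ h1) (hL0τ d₁)) (hF2 hC₂ h2')
          (hΦpos d₃ hd₃ (hL₃ h1) (hL0τ d₁)) (hF2 hC₃ h3')


/-- **Row `#dbl = 3` of `(L_3)`, half `D ∉ 𝒳 ∩ 𝒵`** (`τ ≥ 12`). [this work] -/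
theorem coeff_ladder_three_rowThree_nonneg_nalpha (h𝒳 : IsUpperSet (𝒳 : Set (Finset α))) (h𝒵 : IsUpperSet (𝒵 : Set (Finset α)))
    (hX3 : ∀ S ∈ 𝒳, 3 ≤ #S) (hZ3 : ∀ S ∈ 𝒵, 3 ≤ #S) {m : α →₀ ℕ} (hm : ∀ i, m i ≤ 2) (hD : #(dbl m) = 3)
    (hτ : 12 ≤ #(lev m 1)) (hnD : ¬ (dbl m ∈ 𝒳 ∧ dbl m ∈ 𝒵)) :
    0 ≤ (ee 3 * (PiP * gf (𝒳 ∩ 𝒵) - gf 𝒳 * gf 𝒵) -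
      gf (bySize (· ≤ 3 - 1) : Finset (Finset α)) * gf (bySize (3 ≤ ·) : Finset (Finset α)) *
        gf ((𝒳 ∩ 𝒵).filter fun S => #S = 3)).coeff m := by
  obtain ⟨d₁, d₂, d₃, h12, h13, h23, hDeq⟩ := card_eq_three.1 hD
  have P : ∀ a b c : α, a ≠ b → a ≠ c → b ≠ c → dbl m = {a, b, c} → cE 𝒳 𝒵 m b ≤ cE 𝒳 𝒵 m a → cE 𝒳 𝒵 m c ≤ cE 𝒳 𝒵 m b →
      0 ≤ (ee 3 * (PiP * gf (𝒳 ∩ 𝒵) - gf 𝒳 * gf 𝒵) -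
        gf (bySize (· ≤ 3 - 1) : Finset (Finset α)) * gf (bySize (3 ≤ ·) : Finset (Finset α)) *
          gf ((𝒳 ∩ 𝒵).filter fun S => #S = 3)).coeff m :=
    fun a b c hab hac hbc he hba hcb => rowThree_zero_sorted h𝒳 h𝒵 hX3 hZ3 hm hD hτ hnD he hab hac hbc hba hcb
  have e132 : dbl m = {d₁, d₃, d₂} := by rw [hDeq]; ext x; simp only [mem_insert, mem_singleton]; tauto
  have e213 : dbl m = {d₂, d₁, d₃} := by rw [hDeq]; ext x; simp only [mem_insert, mem_singleton]; tauto
  have e231 : dbl m = {d₂, d₃, d₁} := by rw [hDeq]; ext x; simp only [mem_insert, mem_singleton]; tauto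
  have e312 : dbl m = {d₃, d₁, d₂} := by rw [hDeq]; ext x; simp only [mem_insert, mem_singleton]; tauto
  have e321 : dbl m = {d₃, d₂, d₁} := by rw [hDeq]; ext x; simp only [mem_insert, mem_singleton]; tauto
  rcases le_total (cE 𝒳 𝒵 m d₂) (cE 𝒳 𝒵 m d₁) with h21 | h12'
  · rcases le_total (cE 𝒳 𝒵 m d₃) (cE 𝒳 𝒵 m d₂) with h32 | h23'
    · exact P d₁ d₂ d₃ h12 h13 h23 hDeq h21 h32
    · rcases le_total (cE 𝒳 𝒵 m d₃) (cE 𝒳 𝒵 m d₁) with h31 | h13'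
      · exact P d₁ d₃ d₂ h13 h12 h23.symm e132 h31 h23'
      · exact P d₃ d₁ d₂ h13.symm h23.symm h12 e312 h13' h21
  · rcases le_total (cE 𝒳 𝒵 m d₃) (cE 𝒳 𝒵 m d₁) with h31 | h13'
    · exact P d₂ d₁ d₃ h12.symm h23 h13 e213 h12' h31
    · rcases le_total (cE 𝒳 𝒵 m d₃) (cE 𝒳 𝒵 m d₂) with h32 | h23'
      · exact P d₂ d₃ d₁ h23 h12.symm h13.symm e231 h32 h13'
      · exact P d₃ d₂ d₁ h23.symm h13.symm h12.symm e321 h23' h12'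

/-- **ROW `#dbl = 3` OF THE LEVEL-3 LADDER `(L_3)`** (ROW3-PROOF-g26.md; `τ = #(lev m 1) ≥ 18`): for 3-live up-sets `𝒳, 𝒵` and a profile
`m ≤ 2` with exactly three doubled points, `[m] ( e_3·(Π·GF(𝒳∩𝒵) − GF(𝒳)GF(𝒵)) − Θ_2·e_{≥3}·GF((𝒳∩𝒵)_3) ) ≥ 0`. [this work] -/
theorem coeff_ladder_three_rowThree_nonneg (h𝒳 : IsUpperSet (𝒳 : Set (Finset α))) (h𝒵 : IsUpperSet (𝒵 : Set (Finset α)))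
    (hX3 : ∀ S ∈ 𝒳, 3 ≤ #S) (hZ3 : ∀ S ∈ 𝒵, 3 ≤ #S) {m : α →₀ ℕ} (hm : ∀ i, m i ≤ 2) (hD : #(dbl m) = 3)
    (hτ : 18 ≤ #(lev m 1)) :
    0 ≤ (ee 3 * (PiP * gf (𝒳 ∩ 𝒵) - gf 𝒳 * gf 𝒵) -
      gf (bySize (· ≤ 3 - 1) : Finset (Finset α)) * gf (bySize (3 ≤ ·) : Finset (Finset α)) *
        gf ((𝒳 ∩ 𝒵).filter fun S => #S = 3)).coeff m := by
  by_cases hDc : dbl m ∈ 𝒳 ∧ dbl m ∈ 𝒵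
  · exact coeff_ladder_three_rowThree_nonneg_alpha h𝒳 h𝒵 hX3 hZ3 hm hD hτ hDc.1 hDc.2
  · exact coeff_ladder_three_rowThree_nonneg_nalpha h𝒳 h𝒵 hX3 hZ3 hm hD (by omega) hDc

end RowThreeZeroMain

end Summit.CriticalPhenomena.PercolationContinuityZ3.Theorems.SahiCTCForms
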